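import Literature.IUT.HodgeArakelov.ThetaEvaluationSetting
import Literature.IUT.HodgeTheaters.TemperedCoveringsProofs
import HarnessLib

/-!
# [IUTchII] §2, Remark 2.2.1: the commensurable terminality of `Π_{v▶} ⊆ Π_v` REDUCED to the reference
# decomposition group (proof-only companion of `ThetaEvaluationSetting.lean`)

Mochizuki, *Inter-universal Teichmüller theory II: Hodge–Arakelov-theoretic evaluation*, §2, Remark 2.2.1,
kurims manuscript (Dec. 2020) p. 67 [claim: Mochizuki2012, status: disputed] (IUTchII §2 Rmk 2.2.1, kurims
p.67): "since the subgroup `Π_{v▶} ⊆ Π_v` is commensurably terminal [cf. [IUTchI], Corollary 2.3, (iv)], it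
follows that even when this subgroup is subject to a `Π_v`-conjugacy indeterminacy, the indeterminacy
induced on any specific `Π_v`-conjugate of this subgroup `Π_{v▶}` is an indeterminacy with respect to inner
automorphisms". abc-iut-L6-t1 typed the input fact as the named predicate
`Literature.IUT.HodgeArakelov.Rmk221_commTerminal Dec := IsCommensurablyTerminal Dec.Ptri` on the Prop. 2.2
data `Dec : SubgraphDecomposition S T D` (FACT-LIST row F-1952, "R11: prove or GAP") and proved the inner-ness
consequence `Rmk221_inner`.

This file (abc-iut-w5-d117, DAG node `IUTchII:Rmk2.2.1`) PROVES the reduction the printed sentence performs: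
the field `SubgraphDecomposition.corresponds` records that SOME isomorphism `e : Π_v ≅ Π^tp_{X̲̲_v}` with
the reference group carries `Π_{v▶}` onto a `Π^tp_{X̲̲_v}`-conjugate `g · Π^tp_{X,Γ▶} · g⁻¹` of the
reference decomposition group `refTri` ([IUTchI] Cor. 2.3 (iii)); commensurable terminality is invariant
under group isomorphisms and under conjugation, hence

* `Rmk221_commTerminal_iff_refTri : Rmk221_commTerminal Dec ↔ IsCommensurablyTerminal Dec.refTri` —
  the remark's input is EXACTLY the commensurable terminality of the reference decomposition group
  `Π^tp_{X,Γ▶} ⊆ Π^tp_{X̲̲_v}`, i.e. the content of [IUTchI] Cor. 2.3 (iv) (layer L5: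
  `Literature.IUT.HodgeTheaters.…Cor23iv`, field `tp`, typed over the L5 data; the identification of `refTri`
  with the L5 group `Π^tp_{X,ℍ}` is the L5↔L6 merge datum, not asserted here);
* `Rmk221_commTerminal_of_refTri` — the direction the remark uses;
* `Rmk221_inner_of_refTri` — the printed conclusion ("an indeterminacy with respect to inner
  automorphisms") for `Π_{v▶}` itself, from the reference-group hypothesis, via t1's `Rmk221_inner`;
* `Rmk221_commTerminal_of_cor23iv_bridge` / `Rmk221_commTerminal_of_cor23i_bridge` — the BRIDGE over
  identification data only (shape of abc-iut-w5-d086's `ThetaEvaluationSettingCor23Bridge.lean` for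
  Prop. 2.2 (i)′): given an L5 datum `C : StableCurveTemperedData` (the curve with the sub-semi-graph
  `ℍ := Γ▶_X`) and an isomorphism `j : Π^tp_X ≅ Π^tp_{X̲̲_v}` carrying `Π^tp_{X,ℍ}` (`C.piTpXH`) onto
  `refTri`, the typed [IUTchI] Cor. 2.3 (iv) (`C.Cor23iv` with its hypothesis (a)/(b), or Cor. 2.3 (i) +
  (iii) through abc-iut-L5's PROVED `cor23iv_of_cor23i`) yields `Rmk221_commTerminal Dec` — the R11 row is
  CLOSED MODULO THE L5↔L6 MERGE IDENTIFICATION and the L5 node, no printed input missing, no FACT-LIST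
  request.

The two transport lemmas (`isCommensurablyTerminal_map_equiv_iff`, `isCommensurablyTerminal_conj_iff`)
are plain group theory over the tree's [AbsAnab] Def. 0.1 (iii) predicate
`Literature.AnabelianGeometry.AbsoluteAnabelian.IsCommensurablyTerminal`, proved from abc-iut-L5's
`CommensuratorLemmas` (`comap_of_surjective`, `of_map_injective`). PROOF-ONLY: no `def`, no new `Prop`
fact. HONEST FRAMING: nothing here asserts anything about [IUTchIII] Cor. 3.12; typed ≠ proved for the
reference-group input itself.
-/

namespace Literature.IUT.HodgeArakelov

open Literature.AnabelianGeometry.AbsoluteAnabelian (IsCommensurablyTerminal)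
open scoped Pointwise

universe u

/-! ## Transport of commensurable terminality (plain group theory) -/

section Transport

variable {A B : Type u} [Group A] [Group B]

/-- Commensurable terminality ([AbsAnab] Def. 0.1 (iii)) is invariant under a group isomorphism
`e : A ≃* B`: `e(K) ⊆ B` is commensurably terminal iff `K ⊆ A` is. PROVED (pull back along the surjection
`e⁻¹`, descend along the injection `e`; abc-iut-L5 `CommensuratorLemmas`).
[claim: Mochizuki2012, status: disputed] (IUTchII §2 Rmk 2.2.1, kurims p.67) -/
theorem isCommensurablyTerminal_map_equiv_iff (e : A ≃* B) (K : Subgroup A) :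
    IsCommensurablyTerminal (K.map e.toMonoidHom) ↔ IsCommensurablyTerminal K := by
  constructor
  · intro h
    exact ⟨Literature.IUT.HodgeTheaters.IsCommensurablyTerminal.of_map_injective e.toMonoidHom
      e.injective h.commensurator_eq⟩
  · intro h
    refine ⟨?_⟩
    rw [Subgroup.map_equiv_eq_comap_symm']
    exact Literature.IUT.HodgeTheaters.IsCommensurablyTerminal.comap_of_surjective
      e.symm.toMonoidHom e.symm.surjective h.commensurator_eq

/-- Commensurable terminality is invariant under conjugation: `g K g⁻¹` is commensurably terminal iff
`K` is (the case `e = Inn(g)` of `isCommensurablyTerminal_map_equiv_iff`) — the group-theoretic content of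
"even when this subgroup is subject to a `Π_v`-conjugacy indeterminacy".
[claim: Mochizuki2012, status: disputed] (IUTchII §2 Rmk 2.2.1, kurims p.67) -/
theorem isCommensurablyTerminal_conj_iff (g : A) (K : Subgroup A) :
    IsCommensurablyTerminal (K.map (MulAut.conj g).toMonoidHom) ↔ IsCommensurablyTerminal K :=
  isCommensurablyTerminal_map_equiv_iff (MulAut.conj g) K

end Transport

/-! ## Remark 2.2.1: reduction to the reference decomposition group -/

namespace SubgraphDecomposition

variable {S : BadPlaceSetting.{u}} {P : TopGroup.{u}} {T : TemperedCoverings S P}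
  {D : EtaleThetaData S.toThetaSetting P} (Dec : SubgraphDecomposition S T D)

/-- **IUTchII:Rmk2.2.1** (kurims p. 67), REDUCTION PROVED: the input fact "`Π_{v▶} ⊆ Π_v` is commensurably
terminal" (`Rmk221_commTerminal Dec`) holds iff the reference decomposition group
`Π^tp_{X,Γ▶} ⊆ Π^tp_{X̲̲_v}` (`Dec.refTri`, [IUTchI] Cor. 2.3 (iii)) is commensurably terminal — because
`Π_{v▶}` corresponds, along some `Π_v ≅ Π^tp_{X̲̲_v}`, to a `Π^tp_{X̲̲_v}`-conjugate of `Π^tp_{X,Γ▶}`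
(`SubgraphDecomposition.corresponds`) and commensurable terminality is transported along isomorphisms
and conjugation. The right-hand side is the content of [IUTchI] Cor. 2.3 (iv) for the reference group.
[claim: Mochizuki2012, status: disputed] (IUTchII §2 Rmk 2.2.1, kurims p.67) -/
theorem Rmk221_commTerminal_iff_refTri :
    Rmk221_commTerminal Dec ↔ IsCommensurablyTerminal Dec.refTri := by
  obtain ⟨e, g, htri, -⟩ := Dec.corresponds
  unfold Rmk221_commTerminal
  rw [← isCommensurablyTerminal_map_equiv_iff e.toMulEquiv Dec.Ptri, htri,
    isCommensurablyTerminal_conj_iff]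

/-- **IUTchII:Rmk2.2.1** (kurims p. 67), the direction used by the remark: if the reference
decomposition group `Π^tp_{X,Γ▶} ⊆ Π^tp_{X̲̲_v}` is commensurably terminal ([IUTchI] Cor. 2.3 (iv)),
then so is `Π_{v▶} ⊆ Π_v`, i.e. `Rmk221_commTerminal Dec`. [claim: Mochizuki2012, status: disputed]
(IUTchII §2 Rmk 2.2.1, kurims p.67) -/
theorem Rmk221_commTerminal_of_refTri (h : IsCommensurablyTerminal Dec.refTri) :
    Rmk221_commTerminal Dec :=
  (Rmk221_commTerminal_iff_refTri Dec).2 h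

/-- **IUTchII:Rmk2.2.1** (kurims p. 67), the printed conclusion from the reference-group hypothesis: if
`Π^tp_{X,Γ▶} ⊆ Π^tp_{X̲̲_v}` is commensurably terminal, then any `g ∈ Π_v` normalising `Π_{v▶}` lies
in `Π_{v▶}` — "the indeterminacy induced on any specific `Π_v`-conjugate of this subgroup `Π_{v▶}` is an
indeterminacy with respect to inner automorphisms" (abc-iut-L6-t1's `Rmk221_inner` composed with the
reduction). [claim: Mochizuki2012, status: disputed] (IUTchII §2 Rmk 2.2.1, kurims p.67) -/
theorem Rmk221_inner_of_refTri (h : IsCommensurablyTerminal Dec.refTri) (g : P)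
    (hg : ConjAct.toConjAct g • Dec.Ptri = Dec.Ptri) : g ∈ Dec.Ptri :=
  Rmk221_inner Dec.Ptri (Rmk221_commTerminal_of_refTri Dec h) g hg

/-- The same reduction for the smaller group `Π_{v•}`: `Π_{v•} ⊆ Π_v` is commensurably terminal iff the
reference group `Π^tp_{X,Γ•} ⊆ Π^tp_{X̲̲_v}` (`Dec.refBullet`) is (second clause of
`SubgraphDecomposition.corresponds`; recorded for the `•`-version of the same conjugacy bookkeeping,
[IUTchII] Prop. 2.2 (i) "regarded up to `Π_v`-conjugacy"). [claim: Mochizuki2012, status: disputed]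
(IUTchII §2 Prop 2.2 (i), kurims p.66) -/
theorem isCommensurablyTerminal_bullet_iff_refBullet :
    IsCommensurablyTerminal Dec.Pbullet ↔ IsCommensurablyTerminal Dec.refBullet := by
  obtain ⟨e, g, -, hbul⟩ := Dec.corresponds
  rw [← isCommensurablyTerminal_map_equiv_iff e.toMulEquiv Dec.Pbullet, hbul,
    isCommensurablyTerminal_conj_iff]

/-! ## Bridge to [IUTchI] Cor. 2.3 (iv) over identification data (layer L5) -/

open Literature.IUT.HodgeTheaters in
/-- **IUTchII:Rmk2.2.1 from the typed [IUTchI] Cor. 2.3 (iv)**, BRIDGE over identification data only: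
for an L5 datum `C` ([IUTchI] §2: `X` with the sub-semi-graph `ℍ := Γ▶_X` of [IUTchII] Prop. 2.2, p. 66:
"`Π_{v▶}` … i.e., more precisely, the group “`Π^tp_{X,ℍ}`” of [IUTchI], Corollary 2.3, (iii)") whose `Π^tp_X` is
identified with `Π^tp_{X̲̲_v}` by `j` carrying `Π^tp_{X,ℍ}` onto the reference group `Π^tp_{X,Γ▶}`
(`Dec.refTri`), the typed Cor. 2.3 (iv) (`C.Cor23iv`, under its hypothesis (a)/(b) `C.Cor23Hyp`) gives
`Rmk221_commTerminal Dec`. [claim: Mochizuki2012, status: disputed]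
(IUTchII §2 Rmk 2.2.1, kurims p.67; IUTchI §2 Cor 2.3 (iv), kurims p.47) -/
theorem Rmk221_commTerminal_of_cor23iv_bridge (C : StableCurveTemperedData.{u}) (j : C.PiTp ≃ₜ* S.PiX)
    (htri : Dec.refTri = C.piTpXH.map j.toMulEquiv.toMonoidHom) (h23 : C.Cor23iv) (hyp : C.Cor23Hyp) :
    Rmk221_commTerminal Dec := by
  refine Rmk221_commTerminal_of_refTri Dec ?_
  rw [htri, isCommensurablyTerminal_map_equiv_iff]
  exact h23.tp hyp

open Literature.IUT.HodgeTheaters in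
/-- **IUTchII:Rmk2.2.1 from [IUTchI] Cor. 2.3 (i) + (iii)** through abc-iut-L5's PROVED
`StableCurveTemperedData.cor23iv_of_cor23i` ([IUTchI] p. 49: "In light of the exact sequences of assertion
(iii), assertion (iv) follows immediately from assertion (i)"), over the same identification data.
[claim: Mochizuki2012, status: disputed] (IUTchII §2 Rmk 2.2.1, kurims p.67; IUTchI §2 Cor 2.3 (i)(iii)(iv),
kurims pp.47-49) -/
theorem Rmk221_commTerminal_of_cor23i_bridge (C : StableCurveTemperedData.{u}) (j : C.PiTp ≃ₜ* S.PiX)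
    (htri : Dec.refTri = C.piTpXH.map j.toMulEquiv.toMonoidHom) (hi : C.Cor23i) (hiii : C.Cor23iii)
    (hyp : C.Cor23Hyp) : Rmk221_commTerminal Dec :=
  Rmk221_commTerminal_of_cor23iv_bridge Dec C j htri (C.cor23iv_of_cor23i hi hiii) hyp

end SubgraphDecomposition

end Literature.IUT.HodgeArakelov
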